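import Literature.NumberTheory.Sieve.CFSemigroupRenewalAbstract
import HarnessLib

/-!
# Products in `CfLip` and the holomorphic family of test functions `G · Φ^{-z}`

Support file (all results proved) for the named fact
`Literature.NumberTheory.Sieve.MageeOhWinter2019_uniformCounting` (`CFSemigroupCounting.lean`).
Comparing the lattice-point count with the dynamical count ([MageeOhWinter2019, §3, Lemma 12]:
the hyperbolic displacement differs from the boundary distortion by a cocycle) leads to counting
functions with a threshold modified by a positive Lipschitz function `Φ ≥ 1` of the boundary point,
`#{w : denom(M_w, x) Φ(M_w x) ≤ X}`, whose Laplace transforms involve the test functions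
`G_s = G · Φ^{-2δ s}` depending holomorphically on `s`. This file provides:

* `CfLip.mul`: the pointwise product on `CfLip`, `‖F G‖ ≤ ‖F‖ ‖G‖`;
* `CfThreshold`: the data `Φ ≥ 1`, Lipschitz, `log Φ ≤ Λ` on `[0,1]`; `cfPow Θ z ∈ CfLip`, the function
  `y ↦ Φ(y)^{-z} = e^{-z log Φ(y)}`, with `continuous_cfPow` (continuity in `z` in the `CfLip` norm);
* `cfPowFam Θ G c s = G · Φ^{-c s}` and `hasDerivAt_cfNuL_cfPowFam`: `s ↦ ν(G · Φ^{-cs})` is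
  differentiable (second-order Taylor estimate under the integral). [cite: MageeOhWinter2019, §3.1]

## References

* M. Magee, H. Oh, D. Winter, J. reine angew. Math. 753 (2019) 89–135, §3.1, Lemma 12.
  [MageeOhWinter2019]
-/

noncomputable section

open Set Filter Metric MeasureTheory
open scoped Topology

namespace Literature.NumberTheory.Sieve

variable {A : Finset ℕ}

/-! ### Exponential estimates -/

/-- `‖e^{-zℓ}‖ ≤ e^{‖z‖Λ}` for `0 ≤ ℓ ≤ Λ`. [folklore] -/
theorem norm_cexp_neg_mul_le (z : ℂ) {ℓ Λ : ℝ} (h0 : 0 ≤ ℓ) (hΛ : ℓ ≤ Λ) :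
    ‖Complex.exp (-(z * ℓ))‖ ≤ Real.exp (‖z‖ * Λ) := by
  rw [Complex.norm_exp]
  refine Real.exp_le_exp.2 ?_
  have h1 : (-(z * (ℓ : ℂ))).re ≤ ‖-(z * (ℓ : ℂ))‖ := Complex.re_le_norm _
  rw [norm_neg, norm_mul, Complex.norm_real, Real.norm_of_nonneg h0] at h1
  exact h1.trans (mul_le_mul_of_nonneg_left hΛ (norm_nonneg z))

/-- `‖e^{-zℓ₁} - e^{-zℓ₂}‖ ≤ ‖z‖ e^{2‖z‖Λ} |ℓ₁ - ℓ₂|` for `ℓᵢ ∈ [0, Λ]`. [folklore] -/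
theorem norm_cexp_neg_mul_sub_le (z : ℂ) {ℓ₁ ℓ₂ Λ : ℝ} (h1 : 0 ≤ ℓ₁) (h1Λ : ℓ₁ ≤ Λ) (h2 : 0 ≤ ℓ₂)
    (h2Λ : ℓ₂ ≤ Λ) :
    ‖Complex.exp (-(z * ℓ₁)) - Complex.exp (-(z * ℓ₂))‖ ≤ ‖z‖ * Real.exp (2 * ‖z‖ * Λ) * |ℓ₁ - ℓ₂| := by
  have hΔ : |ℓ₁ - ℓ₂| ≤ Λ := by rw [abs_le]; constructor <;> linarith
  have hfac : Complex.exp (-(z * ℓ₁)) - Complex.exp (-(z * ℓ₂)) =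
      Complex.exp (-(z * ℓ₂)) * (Complex.exp (-(z * ((ℓ₁ - ℓ₂ : ℝ) : ℂ))) - 1) := by
    rw [mul_sub, mul_one, ← Complex.exp_add]
    congr 2
    push_cast
    ring
  rw [hfac, norm_mul]
  have hw : ‖-(z * ((ℓ₁ - ℓ₂ : ℝ) : ℂ))‖ = ‖z‖ * |ℓ₁ - ℓ₂| := by
    rw [norm_neg, norm_mul, Complex.norm_real, Real.norm_eq_abs]
  have hA := norm_cexp_neg_mul_le z h2 h2Λ
  have hB : ‖Complex.exp (-(z * ((ℓ₁ - ℓ₂ : ℝ) : ℂ))) - 1‖ ≤ ‖-(z * ((ℓ₁ - ℓ₂ : ℝ) : ℂ))‖ * Real.exp ‖-(z * ((ℓ₁ - ℓ₂ : ℝ) : ℂ))‖ := by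
    have h' := Complex.norm_exp_sub_sum_le_norm_mul_exp (-(z * ((ℓ₁ - ℓ₂ : ℝ) : ℂ))) 1
    simp only [Finset.range_one, Finset.sum_singleton, pow_zero, Nat.factorial_zero, Nat.cast_one, div_one,
      pow_one] at h'
    exact h'
  rw [hw] at hB
  have hexp : Real.exp (‖z‖ * |ℓ₁ - ℓ₂|) ≤ Real.exp (‖z‖ * Λ) :=
    Real.exp_le_exp.2 (mul_le_mul_of_nonneg_left hΔ (norm_nonneg z))
  calc ‖Complex.exp (-(z * ℓ₂))‖ * ‖Complex.exp (-(z * ((ℓ₁ - ℓ₂ : ℝ) : ℂ))) - 1‖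
      ≤ Real.exp (‖z‖ * Λ) * (‖z‖ * |ℓ₁ - ℓ₂| * Real.exp (‖z‖ * Λ)) := by
        refine mul_le_mul hA (hB.trans ?_) (norm_nonneg _) (Real.exp_pos _).le
        exact mul_le_mul_of_nonneg_left hexp (by positivity)
    _ = ‖z‖ * Real.exp (2 * ‖z‖ * Λ) * |ℓ₁ - ℓ₂| := by
        rw [show 2 * ‖z‖ * Λ = ‖z‖ * Λ + ‖z‖ * Λ by ring, Real.exp_add]; ring

/-- `‖e^{-zℓ} - e^{-z'ℓ}‖ ≤ ‖z - z'‖ Λ e^{(‖z'‖ + ‖z - z'‖)Λ}` for `ℓ ∈ [0, Λ]`. [folklore] -/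
theorem norm_cexp_neg_mul_sub_param_le (z z' : ℂ) {ℓ Λ : ℝ} (h0 : 0 ≤ ℓ) (hΛ : ℓ ≤ Λ) :
    ‖Complex.exp (-(z * ℓ)) - Complex.exp (-(z' * ℓ))‖ ≤
      ‖z - z'‖ * Λ * Real.exp ((‖z'‖ + ‖z - z'‖) * Λ) := by
  have hΛ0 : 0 ≤ Λ := h0.trans hΛ
  have hfac : Complex.exp (-(z * ℓ)) - Complex.exp (-(z' * ℓ)) =
      Complex.exp (-(z' * ℓ)) * (Complex.exp (-((z - z') * ℓ)) - 1) := by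
    rw [mul_sub, mul_one, ← Complex.exp_add]
    congr 2
    ring
  rw [hfac, norm_mul]
  have hw : ‖-((z - z') * (ℓ : ℂ))‖ = ‖z - z'‖ * ℓ := by
    rw [norm_neg, norm_mul, Complex.norm_real, Real.norm_of_nonneg h0]
  have hA := norm_cexp_neg_mul_le z' h0 hΛ
  have hB : ‖Complex.exp (-((z - z') * (ℓ : ℂ))) - 1‖ ≤ ‖-((z - z') * (ℓ : ℂ))‖ * Real.exp ‖-((z - z') * (ℓ : ℂ))‖ := by
    have h' := Complex.norm_exp_sub_sum_le_norm_mul_exp (-((z - z') * (ℓ : ℂ))) 1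
    simp only [Finset.range_one, Finset.sum_singleton, pow_zero, Nat.factorial_zero, Nat.cast_one, div_one,
      pow_one] at h'
    exact h'
  rw [hw] at hB
  have hexp : Real.exp (‖z - z'‖ * ℓ) ≤ Real.exp (‖z - z'‖ * Λ) :=
    Real.exp_le_exp.2 (mul_le_mul_of_nonneg_left hΛ (norm_nonneg _))
  calc ‖Complex.exp (-(z' * ℓ))‖ * ‖Complex.exp (-((z - z') * ℓ)) - 1‖
      ≤ Real.exp (‖z'‖ * Λ) * (‖z - z'‖ * Λ * Real.exp (‖z - z'‖ * Λ)) := by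
        refine mul_le_mul hA (hB.trans ?_) (norm_nonneg _) (Real.exp_pos _).le
        exact mul_le_mul (mul_le_mul_of_nonneg_left hΛ (norm_nonneg _)) hexp (Real.exp_pos _).le
          (by positivity)
    _ = ‖z - z'‖ * Λ * Real.exp ((‖z'‖ + ‖z - z'‖) * Λ) := by rw [add_mul, Real.exp_add]; ring

/-- The mixed second difference:
`‖(e^{-zℓ₁} - e^{-z'ℓ₁}) - (e^{-zℓ₂} - e^{-z'ℓ₂})‖ ≤ ‖z - z'‖ (1 + ‖z‖Λ) e^{4(‖z‖+‖z'‖+‖z-z'‖)Λ} |ℓ₁ - ℓ₂|`.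
[folklore] -/
theorem norm_cexp_mixed_le (z z' : ℂ) {ℓ₁ ℓ₂ Λ : ℝ} (h1 : 0 ≤ ℓ₁) (h1Λ : ℓ₁ ≤ Λ) (h2 : 0 ≤ ℓ₂) (h2Λ : ℓ₂ ≤ Λ) :
    ‖(Complex.exp (-(z * ℓ₁)) - Complex.exp (-(z' * ℓ₁))) - (Complex.exp (-(z * ℓ₂)) - Complex.exp (-(z' * ℓ₂)))‖ ≤
      ‖z - z'‖ * (1 + ‖z‖ * Λ) * Real.exp (4 * (‖z‖ + ‖z'‖ + ‖z - z'‖) * Λ) * |ℓ₁ - ℓ₂| := by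
  have hΛ0 : 0 ≤ Λ := h1.trans h1Λ
  set Δ : ℝ := ℓ₁ - ℓ₂ with hΔdef
  have hΔ : |Δ| ≤ Λ := by rw [hΔdef, abs_le]; constructor <;> linarith
  set M : ℝ := ‖z‖ + ‖z'‖ + ‖z - z'‖ with hMdef
  have hM0 : 0 ≤ M := by positivity
  have hzM : ‖z‖ ≤ M := by rw [hMdef]; linarith [norm_nonneg z', norm_nonneg (z - z')]
  have hz'M : ‖z'‖ ≤ M := by rw [hMdef]; linarith [norm_nonneg z, norm_nonneg (z - z')]
  have hdM : ‖z - z'‖ ≤ M := by rw [hMdef]; linarith [norm_nonneg z, norm_nonneg z']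
  -- algebra: `= (e^{-zℓ₂} - e^{-z'ℓ₂})(e^{-zΔ} - 1) + e^{-z'ℓ₂} (e^{-zΔ} - e^{-z'Δ})`
  have hfac : (Complex.exp (-(z * ℓ₁)) - Complex.exp (-(z' * ℓ₁))) - (Complex.exp (-(z * ℓ₂)) - Complex.exp (-(z' * ℓ₂))) =
      (Complex.exp (-(z * ℓ₂)) - Complex.exp (-(z' * ℓ₂))) * (Complex.exp (-(z * (Δ : ℂ))) - 1) +
        Complex.exp (-(z' * ℓ₂)) * (Complex.exp (-(z * (Δ : ℂ))) - Complex.exp (-(z' * (Δ : ℂ)))) := by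
    have e1 : Complex.exp (-(z * ℓ₁)) = Complex.exp (-(z * ℓ₂)) * Complex.exp (-(z * (Δ : ℂ))) := by
      rw [← Complex.exp_add]; congr 1; rw [hΔdef]; push_cast; ring
    have e2 : Complex.exp (-(z' * ℓ₁)) = Complex.exp (-(z' * ℓ₂)) * Complex.exp (-(z' * (Δ : ℂ))) := by
      rw [← Complex.exp_add]; congr 1; rw [hΔdef]; push_cast; ring
    rw [e1, e2]; ring
  rw [hfac]
  -- bounds for the four factors
  have hT1 : ‖Complex.exp (-(z * ℓ₂)) - Complex.exp (-(z' * ℓ₂))‖ ≤ ‖z - z'‖ * Λ * Real.exp ((‖z'‖ + ‖z - z'‖) * Λ) :=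
    norm_cexp_neg_mul_sub_param_le z z' h2 h2Λ
  have hT2 : ‖Complex.exp (-(z * (Δ : ℂ))) - 1‖ ≤ ‖z‖ * |Δ| * Real.exp (‖z‖ * Λ) := by
    have h : ‖Complex.exp (-(z * (Δ : ℂ))) - 1‖ ≤ ‖-(z * (Δ : ℂ))‖ * Real.exp ‖-(z * (Δ : ℂ))‖ := by
      have h' := Complex.norm_exp_sub_sum_le_norm_mul_exp (-(z * (Δ : ℂ))) 1
      simp only [Finset.range_one, Finset.sum_singleton, pow_zero, Nat.factorial_zero, Nat.cast_one, div_one,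
        pow_one] at h'
      exact h'
    have hw : ‖-(z * (Δ : ℂ))‖ = ‖z‖ * |Δ| := by rw [norm_neg, norm_mul, Complex.norm_real, Real.norm_eq_abs]
    rw [hw] at h
    refine h.trans (mul_le_mul_of_nonneg_left (Real.exp_le_exp.2 ?_) (by positivity))
    exact mul_le_mul_of_nonneg_left hΔ (norm_nonneg z)
  have hT3 : ‖Complex.exp (-(z' * ℓ₂))‖ ≤ Real.exp (‖z'‖ * Λ) := norm_cexp_neg_mul_le z' h2 h2Λ
  have hT4 : ‖Complex.exp (-(z * (Δ : ℂ))) - Complex.exp (-(z' * (Δ : ℂ)))‖ ≤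
      ‖z - z'‖ * |Δ| * Real.exp ((‖z'‖ + ‖z - z'‖) * Λ) := by
    -- factor `e^{-z'Δ}(e^{-(z-z')Δ} - 1)` with `|Δ| ≤ Λ` (Δ may be negative: bound norms by `|Δ|`)
    have hfac' : Complex.exp (-(z * (Δ : ℂ))) - Complex.exp (-(z' * (Δ : ℂ))) =
        Complex.exp (-(z' * (Δ : ℂ))) * (Complex.exp (-((z - z') * (Δ : ℂ))) - 1) := by
      rw [mul_sub, mul_one, ← Complex.exp_add]; congr 2; ring
    rw [hfac', norm_mul]
    have hA : ‖Complex.exp (-(z' * (Δ : ℂ)))‖ ≤ Real.exp (‖z'‖ * Λ) := by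
      rw [Complex.norm_exp]
      refine Real.exp_le_exp.2 ?_
      have h := Complex.re_le_norm (-(z' * (Δ : ℂ)))
      rw [norm_neg, norm_mul, Complex.norm_real, Real.norm_eq_abs] at h
      exact h.trans (mul_le_mul_of_nonneg_left hΔ (norm_nonneg _))
    have hB : ‖Complex.exp (-((z - z') * (Δ : ℂ))) - 1‖ ≤ ‖-((z - z') * (Δ : ℂ))‖ * Real.exp ‖-((z - z') * (Δ : ℂ))‖ := by
      have h' := Complex.norm_exp_sub_sum_le_norm_mul_exp (-((z - z') * (Δ : ℂ))) 1
      simp only [Finset.range_one, Finset.sum_singleton, pow_zero, Nat.factorial_zero, Nat.cast_one, div_one,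
        pow_one] at h'
      exact h'
    have hw : ‖-((z - z') * (Δ : ℂ))‖ = ‖z - z'‖ * |Δ| := by
      rw [norm_neg, norm_mul, Complex.norm_real, Real.norm_eq_abs]
    rw [hw] at hB
    have hexp : Real.exp (‖z - z'‖ * |Δ|) ≤ Real.exp (‖z - z'‖ * Λ) :=
      Real.exp_le_exp.2 (mul_le_mul_of_nonneg_left hΔ (norm_nonneg _))
    calc ‖Complex.exp (-(z' * (Δ : ℂ)))‖ * ‖Complex.exp (-((z - z') * (Δ : ℂ))) - 1‖
        ≤ Real.exp (‖z'‖ * Λ) * (‖z - z'‖ * |Δ| * Real.exp (‖z - z'‖ * Λ)) := by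
          refine mul_le_mul hA (hB.trans ?_) (norm_nonneg _) (Real.exp_pos _).le
          exact mul_le_mul_of_nonneg_left hexp (by positivity)
      _ = ‖z - z'‖ * |Δ| * Real.exp ((‖z'‖ + ‖z - z'‖) * Λ) := by rw [add_mul, Real.exp_add]; ring
  -- assemble with generous exponentials `≤ e^{4MΛ}`
  have hE1 : Real.exp ((‖z'‖ + ‖z - z'‖) * Λ) * Real.exp (‖z‖ * Λ) ≤ Real.exp (4 * M * Λ) := by
    rw [← Real.exp_add]; refine Real.exp_le_exp.2 ?_; nlinarith
  have hE2 : Real.exp (‖z'‖ * Λ) * Real.exp ((‖z'‖ + ‖z - z'‖) * Λ) ≤ Real.exp (4 * M * Λ) := by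
    rw [← Real.exp_add]; refine Real.exp_le_exp.2 ?_; nlinarith
  have hzΛ : ‖z‖ * |Δ| ≤ ‖z‖ * Λ := mul_le_mul_of_nonneg_left hΔ (norm_nonneg z)
  calc ‖(Complex.exp (-(z * ℓ₂)) - Complex.exp (-(z' * ℓ₂))) * (Complex.exp (-(z * (Δ : ℂ))) - 1) +
        Complex.exp (-(z' * ℓ₂)) * (Complex.exp (-(z * (Δ : ℂ))) - Complex.exp (-(z' * (Δ : ℂ))))‖
      ≤ ‖z - z'‖ * Λ * Real.exp ((‖z'‖ + ‖z - z'‖) * Λ) * (‖z‖ * |Δ| * Real.exp (‖z‖ * Λ)) +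
          Real.exp (‖z'‖ * Λ) * (‖z - z'‖ * |Δ| * Real.exp ((‖z'‖ + ‖z - z'‖) * Λ)) := by
        refine (norm_add_le _ _).trans (add_le_add ?_ ?_)
        · rw [norm_mul]; exact mul_le_mul hT1 hT2 (norm_nonneg _) (by positivity)
        · rw [norm_mul]; exact mul_le_mul hT3 hT4 (norm_nonneg _) (by positivity)
    _ = ‖z - z'‖ * |Δ| * ((‖z‖ * Λ) * (Real.exp ((‖z'‖ + ‖z - z'‖) * Λ) * Real.exp (‖z‖ * Λ)) +
          Real.exp (‖z'‖ * Λ) * Real.exp ((‖z'‖ + ‖z - z'‖) * Λ)) := by ring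
    _ ≤ ‖z - z'‖ * |Δ| * ((‖z‖ * Λ) * Real.exp (4 * M * Λ) + Real.exp (4 * M * Λ)) := by
        refine mul_le_mul_of_nonneg_left (add_le_add (mul_le_mul_of_nonneg_left hE1 (by positivity)) hE2)
          (by positivity)
    _ = ‖z - z'‖ * (1 + ‖z‖ * Λ) * Real.exp (4 * (‖z‖ + ‖z'‖ + ‖z - z'‖) * Λ) * |ℓ₁ - ℓ₂| := by
        rw [hMdef, hΔdef]; ring

/-- Second-order Taylor in the parameter: `‖e^{-(z+w)ℓ} - e^{-zℓ} + wℓ e^{-zℓ}‖ ≤ e^{‖z‖Λ} (‖w‖Λ)² e^{‖w‖Λ}`.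
[folklore] -/
theorem norm_cexp_param_taylor_le (z w : ℂ) {ℓ Λ : ℝ} (h0 : 0 ≤ ℓ) (hΛ : ℓ ≤ Λ) :
    ‖Complex.exp (-((z + w) * ℓ)) - Complex.exp (-(z * ℓ)) + w * ℓ * Complex.exp (-(z * ℓ))‖ ≤
      Real.exp (‖z‖ * Λ) * ((‖w‖ * Λ) ^ 2 * Real.exp (‖w‖ * Λ)) := by
  have hfac : Complex.exp (-((z + w) * ℓ)) - Complex.exp (-(z * ℓ)) + w * ℓ * Complex.exp (-(z * ℓ)) =
      Complex.exp (-(z * ℓ)) * (Complex.exp (-(w * ℓ)) - 1 - (-(w * ℓ))) := by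
    rw [show -((z + w) * (ℓ : ℂ)) = -(z * ℓ) + -(w * ℓ) by ring, Complex.exp_add]; ring
  rw [hfac, norm_mul]
  have hA := norm_cexp_neg_mul_le z h0 hΛ
  have hB := Complex.norm_exp_sub_sum_le_norm_mul_exp (-(w * (ℓ : ℂ))) 2
  simp only [Finset.sum_range_succ, Finset.range_one, Finset.sum_singleton, pow_zero, Nat.factorial_zero,
    Nat.cast_one, div_one, pow_one, Nat.factorial_one] at hB
  have hw : ‖-(w * (ℓ : ℂ))‖ = ‖w‖ * ℓ := by rw [norm_neg, norm_mul, Complex.norm_real, Real.norm_of_nonneg h0]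
  rw [hw] at hB
  rw [sub_sub]
  refine mul_le_mul hA (hB.trans ?_) (norm_nonneg _) (Real.exp_pos _).le
  have h1 : ‖w‖ * ℓ ≤ ‖w‖ * Λ := mul_le_mul_of_nonneg_left hΛ (norm_nonneg w)
  have h2 : (‖w‖ * ℓ) ^ 2 ≤ (‖w‖ * Λ) ^ 2 := pow_le_pow_left₀ (by positivity) h1 2
  exact mul_le_mul h2 (Real.exp_le_exp.2 h1) (Real.exp_pos _).le (by positivity)

/-! ### The pointwise product on `CfLip` -/

namespace CfLip

/-- The Lipschitz estimate for pointwise products. [folklore] -/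
theorem mul_lip (F G : CfLip) (x y : Icc (0 : ℝ) 1) :
    ‖F x * G x - F y * G y‖ ≤ (supNorm F * lipNorm G + supNorm G * lipNorm F) * |(x : ℝ) - y| := by
  have e : F x * G x - F y * G y = F x * (G x - G y) + G y * (F x - F y) := by ring
  rw [e]
  calc ‖F x * (G x - G y) + G y * (F x - F y)‖ ≤ ‖F x‖ * ‖G x - G y‖ + ‖G y‖ * ‖F x - F y‖ := by
        refine (norm_add_le _ _).trans (add_le_add ?_ ?_) <;> rw [norm_mul]
    _ ≤ supNorm F * (lipNorm G * |(x : ℝ) - y|) + supNorm G * (lipNorm F * |(x : ℝ) - y|) :=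
        add_le_add (mul_le_mul (F.norm_apply_le_supNorm x) (G.lipNorm_spec x y) (norm_nonneg _) (supNorm_nonneg F))
          (mul_le_mul (G.norm_apply_le_supNorm y) (F.lipNorm_spec x y) (norm_nonneg _) (supNorm_nonneg G))
    _ = (supNorm F * lipNorm G + supNorm G * lipNorm F) * |(x : ℝ) - y| := by ring

/-- **The pointwise product** of two elements of `CfLip`. [folklore] -/
def mul (F G : CfLip) : CfLip :=
  mk' (fun x => F x * G x) (supNorm F * lipNorm G + supNorm G * lipNorm F) (mul_lip F G)

/-- Evaluation of the product. [folklore] -/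
@[simp] theorem mul_apply (F G : CfLip) (x : Icc (0 : ℝ) 1) : F.mul G x = F x * G x := rfl

/-- **Submultiplicativity:** `‖F G‖ ≤ ‖F‖ ‖G‖`. [folklore] -/
theorem norm_mul_le (F G : CfLip) : ‖F.mul G‖ ≤ ‖F‖ * ‖G‖ := by
  have hsF := supNorm_nonneg F
  have hsG := supNorm_nonneg G
  have hlF := lipNorm_nonneg F
  have hlG := lipNorm_nonneg G
  have hM : ∀ x, ‖F.mul G x‖ ≤ supNorm F * supNorm G := fun x => by
    rw [mul_apply, norm_mul]
    exact mul_le_mul (F.norm_apply_le_supNorm x) (G.norm_apply_le_supNorm x) (norm_nonneg _) hsF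
  have h := norm_le_of_bounds (F := F.mul G) (by positivity) hM (fun x y => mul_lip F G x y)
  rw [norm_def F, norm_def G]
  nlinarith [mul_nonneg hlF hlG]

/-- `F (G - G') = F G - F G'`. [folklore] -/
theorem mul_sub (F G G' : CfLip) : F.mul (G - G') = F.mul G - F.mul G' := by
  refine DFunLike.ext _ _ fun x => ?_
  simp only [mul_apply, sub_apply]
  ring

/-- `(F - F') G = F G - F' G`. [folklore] -/
theorem sub_mul (F F' G : CfLip) : (F - F').mul G = F.mul G - F'.mul G := by
  refine DFunLike.ext _ _ fun x => ?_
  simp only [mul_apply, sub_apply]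
  ring

/-- Continuity of `G ↦ F G`. [folklore] -/
theorem continuous_mul_right (F : CfLip) : Continuous fun G : CfLip => F.mul G := by
  refine continuous_iff_continuousAt.2 fun G₀ => ?_
  refine (tendsto_iff_norm_sub_tendsto_zero).2 ?_
  have hb : ∀ G, ‖F.mul G - F.mul G₀‖ ≤ ‖F‖ * ‖G - G₀‖ := fun G => by
    rw [← mul_sub]; exact norm_mul_le F _
  refine squeeze_zero (fun G => norm_nonneg _) hb ?_
  have : Tendsto (fun G : CfLip => ‖F‖ * ‖G - G₀‖) (𝓝 G₀) (𝓝 (‖F‖ * ‖G₀ - G₀‖)) :=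
    (continuous_const.mul (continuous_id.sub continuous_const).norm).tendsto G₀
  simpa using this

end CfLip

/-! ### Thresholds `Φ` and the power functions `Φ^{-z}` -/

/-- The data of a threshold modifier: `Φ ≥ 1` on `[0,1]`, `L`-Lipschitz, with `log Φ ≤ Λ`. [folklore] -/
structure CfThreshold where
  /-- the modifier -/
  Φ : ℝ → ℝ
  /-- a Lipschitz constant on `[0,1]` -/
  L : ℝ
  /-- a bound for `log Φ` on `[0,1]` -/
  Λ : ℝ
  L_nonneg : 0 ≤ L
  one_le : ∀ y ∈ Icc (0 : ℝ) 1, 1 ≤ Φ y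
  log_le : ∀ y ∈ Icc (0 : ℝ) 1, Real.log (Φ y) ≤ Λ
  lip : ∀ x ∈ Icc (0 : ℝ) 1, ∀ y ∈ Icc (0 : ℝ) 1, |Φ x - Φ y| ≤ L * |x - y|

namespace CfThreshold

variable (Θ : CfThreshold)

/-- `Φ > 0` on `[0,1]`. [folklore] -/
theorem pos {y : ℝ} (hy : y ∈ Icc (0 : ℝ) 1) : 0 < Θ.Φ y := lt_of_lt_of_le one_pos (Θ.one_le y hy)

/-- `0 ≤ log Φ` on `[0,1]`. [folklore] -/
theorem log_nonneg {y : ℝ} (hy : y ∈ Icc (0 : ℝ) 1) : 0 ≤ Real.log (Θ.Φ y) := Real.log_nonneg (Θ.one_le y hy)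

/-- `0 ≤ Λ`. [folklore] -/
theorem Λ_nonneg : 0 ≤ Θ.Λ := (Θ.log_nonneg (show (0 : ℝ) ∈ Icc (0 : ℝ) 1 from ⟨le_rfl, zero_le_one⟩)).trans
  (Θ.log_le 0 ⟨le_rfl, zero_le_one⟩)

/-- `log` is `1`-Lipschitz on `[1, ∞)`. [folklore] -/
theorem abs_log_sub_log_le {a b : ℝ} (ha : 1 ≤ a) (hb : 1 ≤ b) : |Real.log a - Real.log b| ≤ |a - b| := by
  have key : ∀ {u v : ℝ}, 1 ≤ v → 0 < u → Real.log u - Real.log v ≤ |u - v| := by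
    intro u v hv hu
    have hv0 : 0 < v := by linarith
    have h1 : Real.log (u / v) ≤ u / v - 1 := Real.log_le_sub_one_of_pos (div_pos hu hv0)
    rw [Real.log_div hu.ne' hv0.ne'] at h1
    have h2 : u / v - 1 = (u - v) / v := by field_simp
    rw [h2] at h1
    calc Real.log u - Real.log v ≤ (u - v) / v := h1
      _ ≤ |u - v| / v := div_le_div_of_nonneg_right (le_abs_self _) hv0.le
      _ ≤ |u - v| := div_le_self (abs_nonneg _) hv
  have h1 := key hb (by linarith : 0 < a)
  have h2 := key ha (by linarith : 0 < b)
  rw [abs_sub_comm b a] at h2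
  rw [abs_le]; constructor <;> linarith

/-- `log Φ` is `L`-Lipschitz on `[0,1]`. [folklore] -/
theorem abs_log_sub_le {x y : ℝ} (hx : x ∈ Icc (0 : ℝ) 1) (hy : y ∈ Icc (0 : ℝ) 1) :
    |Real.log (Θ.Φ x) - Real.log (Θ.Φ y)| ≤ Θ.L * |x - y| :=
  (abs_log_sub_log_le (Θ.one_le x hx) (Θ.one_le y hy)).trans (Θ.lip x hx y hy)

/-- **The power function `y ↦ Φ(y)^{-z} = e^{-z log Φ(y)}` as an element of `CfLip`.** [folklore] -/
def cfPow (z : ℂ) : CfLip :=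
  CfLip.mk' (fun y => Complex.exp (-(z * Real.log (Θ.Φ y)))) (‖z‖ * Real.exp (2 * ‖z‖ * Θ.Λ) * Θ.L) fun x y => by
    refine (norm_cexp_neg_mul_sub_le z (Θ.log_nonneg x.2) (Θ.log_le x x.2) (Θ.log_nonneg y.2) (Θ.log_le y y.2)).trans ?_
    rw [mul_assoc (‖z‖ * Real.exp (2 * ‖z‖ * Θ.Λ))]
    exact mul_le_mul_of_nonneg_left (Θ.abs_log_sub_le x.2 y.2) (by positivity)

/-- Evaluation of `cfPow`. [folklore] -/
@[simp] theorem cfPow_apply (z : ℂ) (y : Icc (0 : ℝ) 1) :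
    Θ.cfPow z y = Complex.exp (-(z * Real.log (Θ.Φ y))) := rfl

/-- For real exponents `cfPow` is the real power `Φ^{-t}`. [folklore] -/
theorem cfPow_ofReal (t : ℝ) (y : Icc (0 : ℝ) 1) : Θ.cfPow (t : ℂ) y = ((Θ.Φ y ^ (-t) : ℝ) : ℂ) := by
  rw [cfPow_apply, Real.rpow_def_of_pos (Θ.pos y.2)]
  push_cast
  ring_nf

/-- **Lipschitz dependence on the exponent:** `‖Φ^{-z} - Φ^{-z'}‖ ≤ ‖z - z'‖ K(z, z')` with an explicit
continuous `K`. [folklore] -/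
theorem norm_cfPow_sub_le (z z' : ℂ) :
    ‖Θ.cfPow z - Θ.cfPow z'‖ ≤ ‖z - z'‖ * ((Θ.Λ + (1 + ‖z‖ * Θ.Λ) * Θ.L) *
      Real.exp (4 * (‖z‖ + ‖z'‖ + ‖z - z'‖) * Θ.Λ)) := by
  have hΛ := Θ.Λ_nonneg
  have hL := Θ.L_nonneg
  set M : ℝ := ‖z‖ + ‖z'‖ + ‖z - z'‖ with hMdef
  have hM0 : 0 ≤ M := by positivity
  have hE : Real.exp ((‖z'‖ + ‖z - z'‖) * Θ.Λ) ≤ Real.exp (4 * M * Θ.Λ) := by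
    refine Real.exp_le_exp.2 ?_; nlinarith [norm_nonneg z, norm_nonneg z', norm_nonneg (z - z')]
  have hsup : ∀ y : Icc (0 : ℝ) 1, ‖(Θ.cfPow z - Θ.cfPow z') y‖ ≤ ‖z - z'‖ * Θ.Λ * Real.exp (4 * M * Θ.Λ) := by
    intro y
    rw [CfLip.sub_apply, cfPow_apply, cfPow_apply]
    refine (norm_cexp_neg_mul_sub_param_le z z' (Θ.log_nonneg y.2) (Θ.log_le y y.2)).trans ?_
    exact mul_le_mul_of_nonneg_left hE (by positivity)
  have hlip : ∀ x y : Icc (0 : ℝ) 1, ‖(Θ.cfPow z - Θ.cfPow z') x - (Θ.cfPow z - Θ.cfPow z') y‖ ≤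
      ‖z - z'‖ * (1 + ‖z‖ * Θ.Λ) * Real.exp (4 * M * Θ.Λ) * Θ.L * |(x : ℝ) - y| := by
    intro x y
    simp only [CfLip.sub_apply, cfPow_apply]
    refine (norm_cexp_mixed_le z z' (Θ.log_nonneg x.2) (Θ.log_le x x.2) (Θ.log_nonneg y.2) (Θ.log_le y y.2)).trans ?_
    rw [mul_assoc (‖z - z'‖ * (1 + ‖z‖ * Θ.Λ) * Real.exp (4 * M * Θ.Λ))]
    exact mul_le_mul_of_nonneg_left (Θ.abs_log_sub_le x.2 y.2) (by positivity)
  refine (CfLip.norm_le_of_bounds (by positivity) hsup hlip).trans (le_of_eq ?_)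
  rw [hMdef]; ring

/-- **`z ↦ Φ^{-z}` is continuous into `CfLip`.** [folklore] -/
theorem continuous_cfPow : Continuous Θ.cfPow := by
  refine continuous_iff_continuousAt.2 fun z₀ => ?_
  refine (tendsto_iff_norm_sub_tendsto_zero).2 ?_
  set K : ℂ → ℝ := fun z => (Θ.Λ + (1 + ‖z‖ * Θ.Λ) * Θ.L) * Real.exp (4 * (‖z‖ + ‖z₀‖ + ‖z - z₀‖) * Θ.Λ) with hK
  have hKc : Continuous K := by
    have hn : Continuous fun z : ℂ => ‖z‖ := continuous_norm
    have hd : Continuous fun z : ℂ => ‖z - z₀‖ := (continuous_id.sub continuous_const).norm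
    refine Continuous.mul (continuous_const.add ((continuous_const.add (hn.mul continuous_const)).mul
      continuous_const)) (Real.continuous_exp.comp ?_)
    exact ((continuous_const.mul ((hn.add continuous_const).add hd)).mul continuous_const)
  refine squeeze_zero (fun z => norm_nonneg _) (fun z => Θ.norm_cfPow_sub_le z z₀) ?_
  have h : Tendsto (fun z => ‖z - z₀‖ * K z) (𝓝 z₀) (𝓝 (‖z₀ - z₀‖ * K z₀)) :=
    ((continuous_id.sub continuous_const).norm.mul hKc).tendsto z₀
  simpa using h

/-! ### The holomorphic family `G · Φ^{-cs}` and the derivative of `s ↦ ν(G · Φ^{-cs})` -/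

/-- The family of test functions `G_s = G · Φ^{-c s}`. [folklore] -/
def cfPowFam (G : CfLip) (c : ℝ) (s : ℂ) : CfLip := G.mul (Θ.cfPow ((c : ℂ) * s))

/-- Evaluation. [folklore] -/
@[simp] theorem cfPowFam_apply (G : CfLip) (c : ℝ) (s : ℂ) (y : Icc (0 : ℝ) 1) :
    Θ.cfPowFam G c s y = G y * Complex.exp (-((c : ℂ) * s * Real.log (Θ.Φ y))) := rfl

/-- **`s ↦ G_s` is continuous into `CfLip`.** [folklore] -/
theorem continuous_cfPowFam (G : CfLip) (c : ℝ) : Continuous (Θ.cfPowFam G c) :=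
  (CfLip.continuous_mul_right G).comp (Θ.continuous_cfPow.comp (continuous_const.mul continuous_id))

/-- For `G` real and `s` real, `G_s` is real: `G_t(y) = Re G(y) · Φ(y)^{-ct}`. [folklore] -/
theorem cfPowFam_ofReal {G : CfLip} (hGre : ∀ y : Icc (0 : ℝ) 1, (((G y).re : ℝ) : ℂ) = G y) (c t : ℝ)
    (y : Icc (0 : ℝ) 1) : Θ.cfPowFam G c (t : ℂ) y = (((G y).re * Θ.Φ y ^ (-(c * t)) : ℝ) : ℂ) := by
  rw [cfPowFam_apply, Real.rpow_def_of_pos (Θ.pos y.2), Complex.ofReal_mul, hGre y, Complex.ofReal_exp]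
  congr 1
  congr 1
  push_cast
  ring

/-- The derivative integrand `y ↦ -c log Φ(y) · G_s(y)`, a continuous function on `[0,1]`. [folklore] -/
theorem continuous_deriv_integrand (G : CfLip) (c : ℝ) (s : ℂ) :
    Continuous fun y : Icc (0 : ℝ) 1 => -((c : ℂ) * Real.log (Θ.Φ y)) * Θ.cfPowFam G c s y :=
  by
  have hΦc : Continuous fun y : Icc (0 : ℝ) 1 => Θ.Φ y := by
    refine Metric.continuous_iff.2 fun y ε hε => ⟨ε / (Θ.L + 1), div_pos hε (by linarith [Θ.L_nonneg]), fun x hx => ?_⟩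
    rw [Real.dist_eq]
    have h := Θ.lip x x.2 y y.2
    have hd : |(x : ℝ) - y| < ε / (Θ.L + 1) := hx
    calc |Θ.Φ x - Θ.Φ y| ≤ Θ.L * |(x : ℝ) - y| := h
      _ ≤ (Θ.L + 1) * |(x : ℝ) - y| := mul_le_mul_of_nonneg_right (by linarith) (abs_nonneg _)
      _ < (Θ.L + 1) * (ε / (Θ.L + 1)) := mul_lt_mul_of_pos_left hd (by linarith [Θ.L_nonneg])
      _ = ε := mul_div_cancel₀ _ (by linarith [Θ.L_nonneg])
  have hlog : Continuous fun y : Icc (0 : ℝ) 1 => (Real.log (Θ.Φ y) : ℂ) :=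
    Complex.continuous_ofReal.comp (hΦc.log fun y => (Θ.pos y.2).ne')
  exact ((continuous_const.mul hlog).neg).mul (Θ.cfPowFam G c s).continuous

/-- **`s ↦ ν(G · Φ^{-cs})` is differentiable** (indeed holomorphic), with derivative
`∫ -c log Φ(y) G_s(y) dν(y)`: second-order Taylor estimate in the exponent, integrated against the
probability measure `ν`. [folklore] -/
theorem hasDerivAt_cfNuL_cfPowFam (hA : ∀ a ∈ A, 1 ≤ a) (h2 : 2 ≤ A.card) (G : CfLip) (c : ℝ) (s : ℂ) :
    HasDerivAt (fun s => cfNuL A hA h2 (Θ.cfPowFam G c s))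
      (∫ y, -((c : ℂ) * Real.log (Θ.Φ y)) * Θ.cfPowFam G c s y ∂(cfNuδ A hA h2)) s := by
  set D : ℂ := ∫ y, -((c : ℂ) * Real.log (Θ.Φ y)) * Θ.cfPowFam G c s y ∂(cfNuδ A hA h2) with hD
  -- the quadratic bound on the remainder
  set C₀ : ℝ := ‖G‖ * Real.exp (‖(c : ℂ) * s‖ * Θ.Λ) * ((|c| * Θ.Λ) ^ 2 * Real.exp (|c| * Θ.Λ)) with hC₀
  have hrem : ∀ k : ℂ, ‖k‖ ≤ 1 →
      ‖cfNuL A hA h2 (Θ.cfPowFam G c (s + k)) - cfNuL A hA h2 (Θ.cfPowFam G c s) - k * D‖ ≤ C₀ * ‖k‖ ^ 2 := by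
    intro k hk
    have hint : ∀ s', Integrable (fun y : Icc (0 : ℝ) 1 => Θ.cfPowFam G c s' y) (cfNuδ A hA h2) := fun s' =>
      integrable_cfLip A hA h2 _
    have hintD : Integrable (fun y : Icc (0 : ℝ) 1 => -((c : ℂ) * Real.log (Θ.Φ y)) * Θ.cfPowFam G c s y)
        (cfNuδ A hA h2) :=
      (Θ.continuous_deriv_integrand G c s).integrable_of_hasCompactSupport (HasCompactSupport.of_compactSpace _)
    have hexpr : cfNuL A hA h2 (Θ.cfPowFam G c (s + k)) - cfNuL A hA h2 (Θ.cfPowFam G c s) - k * D =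
        ∫ y, (Θ.cfPowFam G c (s + k) y - Θ.cfPowFam G c s y -
          k * (-((c : ℂ) * Real.log (Θ.Φ y)) * Θ.cfPowFam G c s y)) ∂(cfNuδ A hA h2) := by
      have hint1 : Integrable (fun y : Icc (0 : ℝ) 1 => Θ.cfPowFam G c (s + k) y - Θ.cfPowFam G c s y)
          (cfNuδ A hA h2) := (hint _).sub (hint _)
      have hint2 : Integrable (fun y : Icc (0 : ℝ) 1 => k * (-((c : ℂ) * Real.log (Θ.Φ y)) * Θ.cfPowFam G c s y))
          (cfNuδ A hA h2) := hintD.const_mul k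
      rw [integral_sub hint1 hint2, integral_sub (hint _) (hint _), integral_const_mul, cfNuL_apply, cfNuL_apply]
    rw [hexpr]
    have hpt : ∀ y : Icc (0 : ℝ) 1, ‖Θ.cfPowFam G c (s + k) y - Θ.cfPowFam G c s y -
        k * (-((c : ℂ) * Real.log (Θ.Φ y)) * Θ.cfPowFam G c s y)‖ ≤ C₀ * ‖k‖ ^ 2 := by
      intro y
      have hℓ0 := Θ.log_nonneg y.2
      have hℓΛ := Θ.log_le y y.2
      have e : Θ.cfPowFam G c (s + k) y - Θ.cfPowFam G c s y - k * (-((c : ℂ) * Real.log (Θ.Φ y)) * Θ.cfPowFam G c s y) =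
          G y * (Complex.exp (-(((c : ℂ) * s + (c : ℂ) * k) * Real.log (Θ.Φ y))) -
            Complex.exp (-((c : ℂ) * s * Real.log (Θ.Φ y))) +
            (c : ℂ) * k * Real.log (Θ.Φ y) * Complex.exp (-((c : ℂ) * s * Real.log (Θ.Φ y)))) := by
        simp only [cfPowFam_apply]
        rw [show (c : ℂ) * (s + k) = (c : ℂ) * s + (c : ℂ) * k by ring]
        ring
      rw [e, norm_mul]
      have hT := norm_cexp_param_taylor_le ((c : ℂ) * s) ((c : ℂ) * k) hℓ0 hℓΛ
      have hck : ‖(c : ℂ) * k‖ = |c| * ‖k‖ := by rw [norm_mul, Complex.norm_real, Real.norm_eq_abs]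
      rw [hck] at hT
      have hk1 : |c| * ‖k‖ * Θ.Λ ≤ |c| * Θ.Λ := by
        have := Θ.Λ_nonneg
        calc |c| * ‖k‖ * Θ.Λ ≤ |c| * 1 * Θ.Λ := by gcongr
          _ = |c| * Θ.Λ := by ring
      calc ‖G y‖ * ‖Complex.exp (-(((c : ℂ) * s + (c : ℂ) * k) * Real.log (Θ.Φ y))) -
              Complex.exp (-((c : ℂ) * s * Real.log (Θ.Φ y))) +
              (c : ℂ) * k * Real.log (Θ.Φ y) * Complex.exp (-((c : ℂ) * s * Real.log (Θ.Φ y)))‖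
          ≤ ‖G‖ * (Real.exp (‖(c : ℂ) * s‖ * Θ.Λ) * ((|c| * ‖k‖ * Θ.Λ) ^ 2 * Real.exp (|c| * ‖k‖ * Θ.Λ))) :=
            mul_le_mul (G.norm_apply_le y) hT (norm_nonneg _) (norm_nonneg G)
        _ ≤ ‖G‖ * (Real.exp (‖(c : ℂ) * s‖ * Θ.Λ) * ((|c| * Θ.Λ) ^ 2 * ‖k‖ ^ 2 * Real.exp (|c| * Θ.Λ))) := by
            refine mul_le_mul_of_nonneg_left (mul_le_mul_of_nonneg_left ?_ (Real.exp_pos _).le) (norm_nonneg G)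
            rw [show (|c| * ‖k‖ * Θ.Λ) ^ 2 = (|c| * Θ.Λ) ^ 2 * ‖k‖ ^ 2 by ring]
            exact mul_le_mul_of_nonneg_left (Real.exp_le_exp.2 hk1) (by positivity)
        _ = C₀ * ‖k‖ ^ 2 := by rw [hC₀]; ring
    have h := norm_integral_le_of_norm_le_const (μ := cfNuδ A hA h2) (C := C₀ * ‖k‖ ^ 2)
      (Eventually.of_forall hpt)
    simpa using h
  -- conclude `HasDerivAt` from the quadratic bound
  rw [hasDerivAt_iff_isLittleO_nhds_zero]
  refine Asymptotics.IsLittleO.of_bound fun ε hε => ?_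
  have hC₀0 : 0 ≤ C₀ := by positivity
  filter_upwards [Metric.ball_mem_nhds (0 : ℂ) (lt_min one_pos (div_pos hε (lt_of_le_of_lt hC₀0 (lt_add_one C₀))))]
    with k hk
  rw [Metric.mem_ball, dist_zero_right, lt_min_iff] at hk
  have h := hrem k hk.1.le
  rw [smul_eq_mul]
  calc ‖cfNuL A hA h2 (Θ.cfPowFam G c (s + k)) - cfNuL A hA h2 (Θ.cfPowFam G c s) - k * D‖
      ≤ C₀ * ‖k‖ ^ 2 := h
    _ = (C₀ * ‖k‖) * ‖k‖ := by ring
    _ ≤ ε * ‖k‖ := by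
        refine mul_le_mul_of_nonneg_right ?_ (norm_nonneg k)
        have : C₀ * ‖k‖ ≤ (C₀ + 1) * (ε / (C₀ + 1)) :=
          mul_le_mul (by linarith) hk.2.le (norm_nonneg k) (by linarith)
        rwa [mul_div_cancel₀ _ (by linarith : C₀ + 1 ≠ 0)] at this

/-- `s ↦ ν(G · Φ^{-cs})` is differentiable. [folklore] -/
theorem differentiableAt_cfNuL_cfPowFam (hA : ∀ a ∈ A, 1 ≤ a) (h2 : 2 ≤ A.card) (G : CfLip) (c : ℝ) (s : ℂ) :
    DifferentiableAt ℂ (fun s => cfNuL A hA h2 (Θ.cfPowFam G c s)) s :=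
  (Θ.hasDerivAt_cfNuL_cfPowFam hA h2 G c s).differentiableAt

end CfThreshold

end Literature.NumberTheory.Sieve
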